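import Summits.BirchSwinnertonDyer.BirchSwinnertonDyer.Theorems.KatoDescentTamePotSupersingularTameUpperRankEqRecordsNoInertia
import Summits.BirchSwinnertonDyer.BirchSwinnertonDyer.Theorems.KatoDescentTamePotSupersingularTameUpperUnitTwistRecordsFlat69
import Summits.BirchSwinnertonDyer.BirchSwinnertonDyer.Theorems.KatoDescentTamePotSupersingularTameUpperUnitTwistRecordsFlat70
import Summits.BirchSwinnertonDyer.BirchSwinnertonDyer.Theorems.KatoDescentTamePotSupersingularTameUpperUnitTwistRecordsSharp41
import Summits.BirchSwinnertonDyer.BirchSwinnertonDyer.Theorems.KatoDescentTamePotSupersingularTameUpperUnitTwistRecordsFlat71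
import Summits.BirchSwinnertonDyer.BirchSwinnertonDyer.Theorems.KatoDescentTamePotSupersingularTameUpperUnitTwistRecordsFlat75
import Summits.BirchSwinnertonDyer.BirchSwinnertonDyer.Theorems.KatoDescentTamePotSupersingularTameUpperUnitTwistRecordsFlat82
import HarnessLib

/-!
# Route `KatoDescentTamePotSupersingular` (rung K8, sub-rung B4 (t′), cell `bsd-potss`): μ-FREE, INERTIA-FREE U₀ RECORDS at `p = 5` FROM THE
# LAYER-0 RANK EQUALITY `rank_5 Cl(ℚ(P)) = rank_5 Cl(ℚ(x(P)))` — KT `5Nn` rows, part 04 (357075cg1, 357075n1, 372400ir1, 372400is1, 396900d1, 435600ll1, 435600ln1)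

Seat `bsd-potss-k8t-c4` g26; `--supports stmt-BirchSwinnertonDyer-19982 --as helper`. THEOREMS ONLY (no definition, no named fact, no `sorry`);
nothing booked; (A), Conjecture A and BSD are proved for NO curve here; items 19202 / 19982 stay OPEN at class level (open inputs class-wide: zeta
crux 24439, lower half of 19984).

Per row `E` (Cremona label, `r_an = 0`, additive potentially supersingular (t′) at `5`, mod-`5` image `C_ns⁺(5)` = LMFDB `5Nn` — the image is a
DISPLAYED hypothesis, the basis data `e hε he σx σs hσx hσs`): `MissingUpperBoundAt E 5` (`ord₅ #Ш(E) ≤ ord₅ #Ш_an(E)`) from the named facts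
`hKatoA hGZK hmod`, Cremona's `r_an = 0`, the basis data and the ONE class-group datum
`hrank : #Cl(ℚ(P))[5] = #Cl(ℚ(x(P)))[5]` (`ℚ(P) = ℚ(E[5])^⟨σ̄_s⟩` of degree 24, `ℚ(x(P)) = ℚ(E[5])^⟨σ̄_x¹², σ̄_s⟩` of degree 12), through the
door `TameRankEqRecords.missingUpperBoundAt_five_tame_of_nonsplitCartanBasis_of_rankEq'` (k8t-c4 g26: g25's rank-equality transfer road with the
inertia input `σ̄_x¹² ∈ I(𝔮|5)` discharged in the kernel by `CoatesSujatha2005.RankEqualityRoad.pow_twelve_mem_inertia_of_nonsplitCartanNormalizer`).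
KERNEL per row (tree certificates, cited by name): `E[5]` irreducible, `Addv E 5`, `SubTprime E 5`.  The numerical value of `hrank` is quoted per
row from the seat's layer-0 census (kit j333672, PARI 2.17: `h(ℚ(x(P)))` with `bnfcertify` where it finished, `h(ℚ(P))` under GRH) — it is a
DISPLAYED HYPOTHESIS, not certified in Lean.  Compare the tree's `TameConjAFiveRecords.missingUpperBoundAt_g<label>_5` μ-road records (seven
classical-`μ` hypotheses each) and the unit-twist records (`TameUpperUnitTwistRecords`, rank-one twist inputs): here ONE layer-0 class-group datum.
CONDITIONAL; per row; nothing booked; BSD for no curve.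

References: [Kato2004Asterisque] Thm. 14.5 (3); [CoatesSujatha2005] Thm. 3.4; [Iwasawa1956]; [Serre1972] §2.2, §5.2 (iii); [Cremona2006] Table 1.
-/

set_option autoImplicit false
-- the Theorems directory repeats the summit name (`Summits/BirchSwinnertonDyer/BirchSwinnertonDyer/…`): house rule of the cell
set_option linter.dupNamespace false

noncomputable section

open scoped Classical NumberField Matrix
open WeierstrassCurve Field IntermediateField
  Literature.NumberTheory.EllipticCurves Literature.NumberTheory.EllipticCurves.Rank1Residual
  Literature.NumberTheory.EllipticCurves.Rank1Residual.Typed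
  Literature.NumberTheory.GaloisRepresentations Literature.NumberTheory.SerreUniformity
  Literature.NumberTheory.IwasawaTheory
  Summit.BirchSwinnertonDyer.Rank1Residual Summit.BirchSwinnertonDyer.Rank1Residual.Additive
  Summit.BirchSwinnertonDyer.BirchSwinnertonDyer.Theorems

namespace Summit.BirchSwinnertonDyer.BirchSwinnertonDyer.Theorems.TameRankEqRecords

/-! ### `357075cg1` @ `p = 5` — `N = 357075 = 3^3·5^2·23^2`; Cremona: `r_an = 0`; (t′) at `5` (Kodaira IV* (e = 3)); ♭; mod-`5` image `5Nn` (LMFDB / census; displayed);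
layer-0 census (kit j333672): `h(ℚ(x(P))) = 1` [CERT] (`5`-rank 0), `h(ℚ(P)) = 2` [GRH] (`5`-rank 0) ⇒ `hrank`: `1 = 1`. -/

/-- **CONDITIONAL U₀ for `357075cg1` @ 5 FROM THE LAYER-0 RANK EQUALITY** — `ord₅ #Ш(E) ≤ ord₅ #Ш_an(E)` (`MissingUpperBoundAt E 5`) for
`E = 357075cg1 = [1, -1, 0, -61992, -1647959]` (`N = 3^3·5^2·23^2`), from: the named facts `hKatoA hGZK hmod`; Cremona's `r_an = 0` (`hr`); the `C_ns⁺(ε)` basis data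
(`e hε he σx σs hσx hσs`, displayed); the rank equality `#Cl(ℚ(P))[5] = #Cl(ℚ(x(P)))[5]` (`hrank`; numerically `1 = 1`: `h(ℚ(x(P))) = 1`
[CERT], `h(ℚ(P)) = 2` [GRH], kit j333672).  NO `μ`-hypothesis, NO inertia hypothesis.  KERNEL: `E[5]` irreducible, `Addv`, `SubTprime`
(tree: `TameUpperUnitTwistRecords.irr_g357075cg1_5`, `addv_g357075cg1_5`, `subTprime_g357075cg1_5`).  Per row; CONDITIONAL; nothing booked; BSD is not proved by this.
[cite: Kato2004Asterisque, Thm. 14.5 (3) (p. 236)] [cite: CoatesSujatha2005, §3 Thm. 3.4] [cite: Iwasawa1956, §§3–5]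
[cite: Cremona2006, Table 1 (Cremona label 357075cg1)] -/
theorem missingUpperBoundAt_g357075cg1_5_of_rankEq
    (hKatoA : Kato2004.rankZero_padicValNat_sha_add_padicValNat_tamagawa_le_of_additive_potGood_of_irreducible_of_fineSelmerDual_fg)
    (hGZK : rank_eq_analyticRank_of_analyticRank_le_one) (hmod : hasEntireLFunction_rat)
    {W : WeierstrassCurve ℚ} [W.IsElliptic] [W.IsGloballyMinimal] (hWeq : W = (⟨1, (-1), 0, (-61992), (-1647959)⟩ : WeierstrassCurve ℚ))
    (hr : W.analyticRank = 0)
    (e : W.geomTorsion (5 : ℕ) ≃+ (Fin 2 → ZMod 5)) {ε : ZMod 5} (hε : ¬ IsSquare ε)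
    (he : ∀ σ : absoluteGaloisGroup ℚ, ∃ M ∈ nonsplitCartanNormalizer ε, ∀ P : W.geomTorsion (5 : ℕ), e (σ • P) = M *ᵥ e P)
    (σx σs : absoluteGaloisGroup ℚ) (hσx : ∀ P : W.geomTorsion (5 : ℕ), e (σx • P) = !![1, ε * (4 - ε); 4 - ε, 1] *ᵥ e P)
    (hσs : ∀ P : W.geomTorsion (5 : ℕ), e (σs • P) = !![1, 0; 0, 4] *ᵥ e P)
    (hrank : Nat.card {d : ClassGroup (𝓞 ↥(fixedField (Subgroup.zpowers (absRestrictNormalHom (W.divisionField 5) σs)))) // d ^ 5 = 1} =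
      Nat.card {d : ClassGroup (𝓞 ↥(fixedField (Subgroup.zpowers (absRestrictNormalHom (W.divisionField 5) σx ^ 12) ⊔
        Subgroup.zpowers (absRestrictNormalHom (W.divisionField 5) σs)))) // d ^ 5 = 1}) :
    MissingUpperBoundAt W 5 := by
  subst hWeq
  exact missingUpperBoundAt_five_tame_of_nonsplitCartanBasis_of_rankEq' _ hKatoA hGZK hmod hr
    TameUpperUnitTwistRecords.addv_g357075cg1_5 TameUpperUnitTwistRecords.subTprime_g357075cg1_5 TameUpperUnitTwistRecords.irr_g357075cg1_5
    e hε he σx σs hσx hσs hrank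

/-! ### `357075n1` @ `p = 5` — `N = 357075 = 3^3·5^2·23^2`; Cremona: `r_an = 0`; (t′) at `5` (Kodaira II (e = 6)); ♭; mod-`5` image `5Nn` (LMFDB / census; displayed);
layer-0 census (kit j333672): `h(ℚ(x(P))) = 1` [CERT] (`5`-rank 0), `h(ℚ(P)) = 2` [GRH] (`5`-rank 0) ⇒ `hrank`: `1 = 1`. -/

/-- **CONDITIONAL U₀ for `357075n1` @ 5 FROM THE LAYER-0 RANK EQUALITY** — `ord₅ #Ш(E) ≤ ord₅ #Ш_an(E)` (`MissingUpperBoundAt E 5`) for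
`E = 357075n1 = [1, -1, 1, -2480, -12688]` (`N = 3^3·5^2·23^2`), from: the named facts `hKatoA hGZK hmod`; Cremona's `r_an = 0` (`hr`); the `C_ns⁺(ε)` basis data
(`e hε he σx σs hσx hσs`, displayed); the rank equality `#Cl(ℚ(P))[5] = #Cl(ℚ(x(P)))[5]` (`hrank`; numerically `1 = 1`: `h(ℚ(x(P))) = 1`
[CERT], `h(ℚ(P)) = 2` [GRH], kit j333672).  NO `μ`-hypothesis, NO inertia hypothesis.  KERNEL: `E[5]` irreducible, `Addv`, `SubTprime`
(tree: `TameUpperUnitTwistRecords.irr_g357075n1_5`, `addv_g357075n1_5`, `subTprime_g357075n1_5`).  Per row; CONDITIONAL; nothing booked; BSD is not proved by this.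
[cite: Kato2004Asterisque, Thm. 14.5 (3) (p. 236)] [cite: CoatesSujatha2005, §3 Thm. 3.4] [cite: Iwasawa1956, §§3–5]
[cite: Cremona2006, Table 1 (Cremona label 357075n1)] -/
theorem missingUpperBoundAt_g357075n1_5_of_rankEq
    (hKatoA : Kato2004.rankZero_padicValNat_sha_add_padicValNat_tamagawa_le_of_additive_potGood_of_irreducible_of_fineSelmerDual_fg)
    (hGZK : rank_eq_analyticRank_of_analyticRank_le_one) (hmod : hasEntireLFunction_rat)
    {W : WeierstrassCurve ℚ} [W.IsElliptic] [W.IsGloballyMinimal] (hWeq : W = (⟨1, (-1), 1, (-2480), (-12688)⟩ : WeierstrassCurve ℚ))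
    (hr : W.analyticRank = 0)
    (e : W.geomTorsion (5 : ℕ) ≃+ (Fin 2 → ZMod 5)) {ε : ZMod 5} (hε : ¬ IsSquare ε)
    (he : ∀ σ : absoluteGaloisGroup ℚ, ∃ M ∈ nonsplitCartanNormalizer ε, ∀ P : W.geomTorsion (5 : ℕ), e (σ • P) = M *ᵥ e P)
    (σx σs : absoluteGaloisGroup ℚ) (hσx : ∀ P : W.geomTorsion (5 : ℕ), e (σx • P) = !![1, ε * (4 - ε); 4 - ε, 1] *ᵥ e P)
    (hσs : ∀ P : W.geomTorsion (5 : ℕ), e (σs • P) = !![1, 0; 0, 4] *ᵥ e P)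
    (hrank : Nat.card {d : ClassGroup (𝓞 ↥(fixedField (Subgroup.zpowers (absRestrictNormalHom (W.divisionField 5) σs)))) // d ^ 5 = 1} =
      Nat.card {d : ClassGroup (𝓞 ↥(fixedField (Subgroup.zpowers (absRestrictNormalHom (W.divisionField 5) σx ^ 12) ⊔
        Subgroup.zpowers (absRestrictNormalHom (W.divisionField 5) σs)))) // d ^ 5 = 1}) :
    MissingUpperBoundAt W 5 := by
  subst hWeq
  exact missingUpperBoundAt_five_tame_of_nonsplitCartanBasis_of_rankEq' _ hKatoA hGZK hmod hr
    TameUpperUnitTwistRecords.addv_g357075n1_5 TameUpperUnitTwistRecords.subTprime_g357075n1_5 TameUpperUnitTwistRecords.irr_g357075n1_5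
    e hε he σx σs hσx hσs hrank

/-! ### `372400ir1` @ `p = 5` — `N = 372400 = 2^4·5^2·7^2·19`; Cremona: `r_an = 0`; (t′) at `5` (Kodaira IV* (e = 3)); ♭; mod-`5` image `5Nn` (LMFDB / census; displayed);
layer-0 census (kit j333672): `h(ℚ(x(P))) = 1` [CERT] (`5`-rank 0), `h(ℚ(P)) = 4` [GRH] (`5`-rank 0) ⇒ `hrank`: `1 = 1`. -/

/-- **CONDITIONAL U₀ for `372400ir1` @ 5 FROM THE LAYER-0 RANK EQUALITY** — `ord₅ #Ш(E) ≤ ord₅ #Ш_an(E)` (`MissingUpperBoundAt E 5`) for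
`E = 372400ir1 = [0, -1, 0, 77292, 11296412]` (`N = 2^4·5^2·7^2·19`), from: the named facts `hKatoA hGZK hmod`; Cremona's `r_an = 0` (`hr`); the `C_ns⁺(ε)` basis data
(`e hε he σx σs hσx hσs`, displayed); the rank equality `#Cl(ℚ(P))[5] = #Cl(ℚ(x(P)))[5]` (`hrank`; numerically `1 = 1`: `h(ℚ(x(P))) = 1`
[CERT], `h(ℚ(P)) = 4` [GRH], kit j333672).  NO `μ`-hypothesis, NO inertia hypothesis.  KERNEL: `E[5]` irreducible, `Addv`, `SubTprime`
(tree: `TameUpperUnitTwistRecords.irr_g372400ir1_5`, `addv_g372400ir1_5`, `subTprime_g372400ir1_5`).  Per row; CONDITIONAL; nothing booked; BSD is not proved by this.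
[cite: Kato2004Asterisque, Thm. 14.5 (3) (p. 236)] [cite: CoatesSujatha2005, §3 Thm. 3.4] [cite: Iwasawa1956, §§3–5]
[cite: Cremona2006, Table 1 (Cremona label 372400ir1)] -/
theorem missingUpperBoundAt_g372400ir1_5_of_rankEq
    (hKatoA : Kato2004.rankZero_padicValNat_sha_add_padicValNat_tamagawa_le_of_additive_potGood_of_irreducible_of_fineSelmerDual_fg)
    (hGZK : rank_eq_analyticRank_of_analyticRank_le_one) (hmod : hasEntireLFunction_rat)
    {W : WeierstrassCurve ℚ} [W.IsElliptic] [W.IsGloballyMinimal] (hWeq : W = (⟨0, (-1), 0, 77292, 11296412⟩ : WeierstrassCurve ℚ))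
    (hr : W.analyticRank = 0)
    (e : W.geomTorsion (5 : ℕ) ≃+ (Fin 2 → ZMod 5)) {ε : ZMod 5} (hε : ¬ IsSquare ε)
    (he : ∀ σ : absoluteGaloisGroup ℚ, ∃ M ∈ nonsplitCartanNormalizer ε, ∀ P : W.geomTorsion (5 : ℕ), e (σ • P) = M *ᵥ e P)
    (σx σs : absoluteGaloisGroup ℚ) (hσx : ∀ P : W.geomTorsion (5 : ℕ), e (σx • P) = !![1, ε * (4 - ε); 4 - ε, 1] *ᵥ e P)
    (hσs : ∀ P : W.geomTorsion (5 : ℕ), e (σs • P) = !![1, 0; 0, 4] *ᵥ e P)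
    (hrank : Nat.card {d : ClassGroup (𝓞 ↥(fixedField (Subgroup.zpowers (absRestrictNormalHom (W.divisionField 5) σs)))) // d ^ 5 = 1} =
      Nat.card {d : ClassGroup (𝓞 ↥(fixedField (Subgroup.zpowers (absRestrictNormalHom (W.divisionField 5) σx ^ 12) ⊔
        Subgroup.zpowers (absRestrictNormalHom (W.divisionField 5) σs)))) // d ^ 5 = 1}) :
    MissingUpperBoundAt W 5 := by
  subst hWeq
  exact missingUpperBoundAt_five_tame_of_nonsplitCartanBasis_of_rankEq' _ hKatoA hGZK hmod hr
    TameUpperUnitTwistRecords.addv_g372400ir1_5 TameUpperUnitTwistRecords.subTprime_g372400ir1_5 TameUpperUnitTwistRecords.irr_g372400ir1_5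
    e hε he σx σs hσx hσs hrank

/-! ### `372400is1` @ `p = 5` — `N = 372400 = 2^4·5^2·7^2·19`; Cremona: `r_an = 0`; (t′) at `5` (Kodaira II (e = 6)); ♯; mod-`5` image `5Nn` (LMFDB / census; displayed);
layer-0 census (kit j333672): `h(ℚ(x(P))) = 1` [CERT] (`5`-rank 0), `h(ℚ(P)) = 4` [GRH] (`5`-rank 0) ⇒ `hrank`: `1 = 1`. -/

/-- **CONDITIONAL U₀ for `372400is1` @ 5 FROM THE LAYER-0 RANK EQUALITY** — `ord₅ #Ш(E) ≤ ord₅ #Ш_an(E)` (`MissingUpperBoundAt E 5`) for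
`E = 372400is1 = [0, -1, 0, 151492, -31118548]` (`N = 2^4·5^2·7^2·19`), from: the named facts `hKatoA hGZK hmod`; Cremona's `r_an = 0` (`hr`); the `C_ns⁺(ε)` basis data
(`e hε he σx σs hσx hσs`, displayed); the rank equality `#Cl(ℚ(P))[5] = #Cl(ℚ(x(P)))[5]` (`hrank`; numerically `1 = 1`: `h(ℚ(x(P))) = 1`
[CERT], `h(ℚ(P)) = 4` [GRH], kit j333672).  NO `μ`-hypothesis, NO inertia hypothesis.  KERNEL: `E[5]` irreducible, `Addv`, `SubTprime`
(tree: `TameUpperUnitTwistRecords.irr_g372400is1_5`, `addv_g372400is1_5`, `subTprime_g372400is1_5`).  Per row; CONDITIONAL; nothing booked; BSD is not proved by this.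
[cite: Kato2004Asterisque, Thm. 14.5 (3) (p. 236)] [cite: CoatesSujatha2005, §3 Thm. 3.4] [cite: Iwasawa1956, §§3–5]
[cite: Cremona2006, Table 1 (Cremona label 372400is1)] -/
theorem missingUpperBoundAt_g372400is1_5_of_rankEq
    (hKatoA : Kato2004.rankZero_padicValNat_sha_add_padicValNat_tamagawa_le_of_additive_potGood_of_irreducible_of_fineSelmerDual_fg)
    (hGZK : rank_eq_analyticRank_of_analyticRank_le_one) (hmod : hasEntireLFunction_rat)
    {W : WeierstrassCurve ℚ} [W.IsElliptic] [W.IsGloballyMinimal] (hWeq : W = (⟨0, (-1), 0, 151492, (-31118548)⟩ : WeierstrassCurve ℚ))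
    (hr : W.analyticRank = 0)
    (e : W.geomTorsion (5 : ℕ) ≃+ (Fin 2 → ZMod 5)) {ε : ZMod 5} (hε : ¬ IsSquare ε)
    (he : ∀ σ : absoluteGaloisGroup ℚ, ∃ M ∈ nonsplitCartanNormalizer ε, ∀ P : W.geomTorsion (5 : ℕ), e (σ • P) = M *ᵥ e P)
    (σx σs : absoluteGaloisGroup ℚ) (hσx : ∀ P : W.geomTorsion (5 : ℕ), e (σx • P) = !![1, ε * (4 - ε); 4 - ε, 1] *ᵥ e P)
    (hσs : ∀ P : W.geomTorsion (5 : ℕ), e (σs • P) = !![1, 0; 0, 4] *ᵥ e P)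
    (hrank : Nat.card {d : ClassGroup (𝓞 ↥(fixedField (Subgroup.zpowers (absRestrictNormalHom (W.divisionField 5) σs)))) // d ^ 5 = 1} =
      Nat.card {d : ClassGroup (𝓞 ↥(fixedField (Subgroup.zpowers (absRestrictNormalHom (W.divisionField 5) σx ^ 12) ⊔
        Subgroup.zpowers (absRestrictNormalHom (W.divisionField 5) σs)))) // d ^ 5 = 1}) :
    MissingUpperBoundAt W 5 := by
  subst hWeq
  exact missingUpperBoundAt_five_tame_of_nonsplitCartanBasis_of_rankEq' _ hKatoA hGZK hmod hr
    TameUpperUnitTwistRecords.addv_g372400is1_5 TameUpperUnitTwistRecords.subTprime_g372400is1_5 TameUpperUnitTwistRecords.irr_g372400is1_5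
    e hε he σx σs hσx hσs hrank

/-! ### `396900d1` @ `p = 5` — `N = 396900 = 2^2·3^4·5^2·7^2`; Cremona: `r_an = 0`; (t′) at `5` (Kodaira IV* (e = 3)); ♭; mod-`5` image `5Nn` (LMFDB / census; displayed);
layer-0 census (kit j333672): `h(ℚ(x(P))) = 30` [CERT] (`5`-rank 1), `h(ℚ(P)) = 60` [GRH] (`5`-rank 1) ⇒ `hrank`: `5^1 = 5^1`. -/

/-- **CONDITIONAL U₀ for `396900d1` @ 5 FROM THE LAYER-0 RANK EQUALITY** — `ord₅ #Ш(E) ≤ ord₅ #Ш_an(E)` (`MissingUpperBoundAt E 5`) for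
`E = 396900d1 = [0, 0, 0, -1509375, -713746250]` (`N = 2^2·3^4·5^2·7^2`), from: the named facts `hKatoA hGZK hmod`; Cremona's `r_an = 0` (`hr`); the `C_ns⁺(ε)` basis data
(`e hε he σx σs hσx hσs`, displayed); the rank equality `#Cl(ℚ(P))[5] = #Cl(ℚ(x(P)))[5]` (`hrank`; numerically `5^1 = 5^1`: `h(ℚ(x(P))) = 30`
[CERT], `h(ℚ(P)) = 60` [GRH], kit j333672).  NO `μ`-hypothesis, NO inertia hypothesis.  KERNEL: `E[5]` irreducible, `Addv`, `SubTprime`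
(tree: `TameUpperUnitTwistRecords.irr_g396900d1_5`, `addv_g396900d1_5`, `subTprime_g396900d1_5`).  Per row; CONDITIONAL; nothing booked; BSD is not proved by this.
[cite: Kato2004Asterisque, Thm. 14.5 (3) (p. 236)] [cite: CoatesSujatha2005, §3 Thm. 3.4] [cite: Iwasawa1956, §§3–5]
[cite: Cremona2006, Table 1 (Cremona label 396900d1)] -/
theorem missingUpperBoundAt_g396900d1_5_of_rankEq
    (hKatoA : Kato2004.rankZero_padicValNat_sha_add_padicValNat_tamagawa_le_of_additive_potGood_of_irreducible_of_fineSelmerDual_fg)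
    (hGZK : rank_eq_analyticRank_of_analyticRank_le_one) (hmod : hasEntireLFunction_rat)
    {W : WeierstrassCurve ℚ} [W.IsElliptic] [W.IsGloballyMinimal] (hWeq : W = (⟨0, 0, 0, (-1509375), (-713746250)⟩ : WeierstrassCurve ℚ))
    (hr : W.analyticRank = 0)
    (e : W.geomTorsion (5 : ℕ) ≃+ (Fin 2 → ZMod 5)) {ε : ZMod 5} (hε : ¬ IsSquare ε)
    (he : ∀ σ : absoluteGaloisGroup ℚ, ∃ M ∈ nonsplitCartanNormalizer ε, ∀ P : W.geomTorsion (5 : ℕ), e (σ • P) = M *ᵥ e P)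
    (σx σs : absoluteGaloisGroup ℚ) (hσx : ∀ P : W.geomTorsion (5 : ℕ), e (σx • P) = !![1, ε * (4 - ε); 4 - ε, 1] *ᵥ e P)
    (hσs : ∀ P : W.geomTorsion (5 : ℕ), e (σs • P) = !![1, 0; 0, 4] *ᵥ e P)
    (hrank : Nat.card {d : ClassGroup (𝓞 ↥(fixedField (Subgroup.zpowers (absRestrictNormalHom (W.divisionField 5) σs)))) // d ^ 5 = 1} =
      Nat.card {d : ClassGroup (𝓞 ↥(fixedField (Subgroup.zpowers (absRestrictNormalHom (W.divisionField 5) σx ^ 12) ⊔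
        Subgroup.zpowers (absRestrictNormalHom (W.divisionField 5) σs)))) // d ^ 5 = 1}) :
    MissingUpperBoundAt W 5 := by
  subst hWeq
  exact missingUpperBoundAt_five_tame_of_nonsplitCartanBasis_of_rankEq' _ hKatoA hGZK hmod hr
    TameUpperUnitTwistRecords.addv_g396900d1_5 TameUpperUnitTwistRecords.subTprime_g396900d1_5 TameUpperUnitTwistRecords.irr_g396900d1_5
    e hε he σx σs hσx hσs hrank

/-! ### `435600ll1` @ `p = 5` — `N = 435600 = 2^4·3^2·5^2·11^2`; Cremona: `r_an = 0`; (t′) at `5` (Kodaira IV* (e = 3)); ♭; mod-`5` image `5Nn` (LMFDB / census; displayed);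
layer-0 census (kit j333672): `h(ℚ(x(P))) = 2` [CERT] (`5`-rank 0), `h(ℚ(P)) = 8` [GRH] (`5`-rank 0) ⇒ `hrank`: `1 = 1`. -/

/-- **CONDITIONAL U₀ for `435600ll1` @ 5 FROM THE LAYER-0 RANK EQUALITY** — `ord₅ #Ш(E) ≤ ord₅ #Ш_an(E)` (`MissingUpperBoundAt E 5`) for
`E = 435600ll1 = [0, 0, 0, -47416875, -125674683750]` (`N = 2^4·3^2·5^2·11^2`), from: the named facts `hKatoA hGZK hmod`; Cremona's `r_an = 0` (`hr`); the `C_ns⁺(ε)` basis data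
(`e hε he σx σs hσx hσs`, displayed); the rank equality `#Cl(ℚ(P))[5] = #Cl(ℚ(x(P)))[5]` (`hrank`; numerically `1 = 1`: `h(ℚ(x(P))) = 2`
[CERT], `h(ℚ(P)) = 8` [GRH], kit j333672).  NO `μ`-hypothesis, NO inertia hypothesis.  KERNEL: `E[5]` irreducible, `Addv`, `SubTprime`
(tree: `TameUpperUnitTwistRecords.irr_g435600ll1_5`, `addv_g435600ll1_5`, `subTprime_g435600ll1_5`).  Per row; CONDITIONAL; nothing booked; BSD is not proved by this.
[cite: Kato2004Asterisque, Thm. 14.5 (3) (p. 236)] [cite: CoatesSujatha2005, §3 Thm. 3.4] [cite: Iwasawa1956, §§3–5]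
[cite: Cremona2006, Table 1 (Cremona label 435600ll1)] -/
theorem missingUpperBoundAt_g435600ll1_5_of_rankEq
    (hKatoA : Kato2004.rankZero_padicValNat_sha_add_padicValNat_tamagawa_le_of_additive_potGood_of_irreducible_of_fineSelmerDual_fg)
    (hGZK : rank_eq_analyticRank_of_analyticRank_le_one) (hmod : hasEntireLFunction_rat)
    {W : WeierstrassCurve ℚ} [W.IsElliptic] [W.IsGloballyMinimal] (hWeq : W = (⟨0, 0, 0, (-47416875), (-125674683750)⟩ : WeierstrassCurve ℚ))
    (hr : W.analyticRank = 0)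
    (e : W.geomTorsion (5 : ℕ) ≃+ (Fin 2 → ZMod 5)) {ε : ZMod 5} (hε : ¬ IsSquare ε)
    (he : ∀ σ : absoluteGaloisGroup ℚ, ∃ M ∈ nonsplitCartanNormalizer ε, ∀ P : W.geomTorsion (5 : ℕ), e (σ • P) = M *ᵥ e P)
    (σx σs : absoluteGaloisGroup ℚ) (hσx : ∀ P : W.geomTorsion (5 : ℕ), e (σx • P) = !![1, ε * (4 - ε); 4 - ε, 1] *ᵥ e P)
    (hσs : ∀ P : W.geomTorsion (5 : ℕ), e (σs • P) = !![1, 0; 0, 4] *ᵥ e P)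
    (hrank : Nat.card {d : ClassGroup (𝓞 ↥(fixedField (Subgroup.zpowers (absRestrictNormalHom (W.divisionField 5) σs)))) // d ^ 5 = 1} =
      Nat.card {d : ClassGroup (𝓞 ↥(fixedField (Subgroup.zpowers (absRestrictNormalHom (W.divisionField 5) σx ^ 12) ⊔
        Subgroup.zpowers (absRestrictNormalHom (W.divisionField 5) σs)))) // d ^ 5 = 1}) :
    MissingUpperBoundAt W 5 := by
  subst hWeq
  exact missingUpperBoundAt_five_tame_of_nonsplitCartanBasis_of_rankEq' _ hKatoA hGZK hmod hr
    TameUpperUnitTwistRecords.addv_g435600ll1_5 TameUpperUnitTwistRecords.subTprime_g435600ll1_5 TameUpperUnitTwistRecords.irr_g435600ll1_5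
    e hε he σx σs hσx hσs hrank

/-! ### `435600ln1` @ `p = 5` — `N = 435600 = 2^4·3^2·5^2·11^2`; Cremona: `r_an = 0`; (t′) at `5` (Kodaira IV* (e = 3)); ♭; mod-`5` image `5Nn` (LMFDB / census; displayed);
layer-0 census (kit j333672): `h(ℚ(x(P))) = 2` [CERT] (`5`-rank 0), `h(ℚ(P)) = 8` [GRH] (`5`-rank 0) ⇒ `hrank`: `1 = 1`. -/

/-- **CONDITIONAL U₀ for `435600ln1` @ 5 FROM THE LAYER-0 RANK EQUALITY** — `ord₅ #Ш(E) ≤ ord₅ #Ш_an(E)` (`MissingUpperBoundAt E 5`) for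
`E = 435600ln1 = [0, 0, 0, -426751875, 3393216461250]` (`N = 2^4·3^2·5^2·11^2`), from: the named facts `hKatoA hGZK hmod`; Cremona's `r_an = 0` (`hr`); the `C_ns⁺(ε)` basis data
(`e hε he σx σs hσx hσs`, displayed); the rank equality `#Cl(ℚ(P))[5] = #Cl(ℚ(x(P)))[5]` (`hrank`; numerically `1 = 1`: `h(ℚ(x(P))) = 2`
[CERT], `h(ℚ(P)) = 8` [GRH], kit j333672).  NO `μ`-hypothesis, NO inertia hypothesis.  KERNEL: `E[5]` irreducible, `Addv`, `SubTprime`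
(tree: `TameUpperUnitTwistRecords.irr_g435600ln1_5`, `addv_g435600ln1_5`, `subTprime_g435600ln1_5`).  Per row; CONDITIONAL; nothing booked; BSD is not proved by this.
[cite: Kato2004Asterisque, Thm. 14.5 (3) (p. 236)] [cite: CoatesSujatha2005, §3 Thm. 3.4] [cite: Iwasawa1956, §§3–5]
[cite: Cremona2006, Table 1 (Cremona label 435600ln1)] -/
theorem missingUpperBoundAt_g435600ln1_5_of_rankEq
    (hKatoA : Kato2004.rankZero_padicValNat_sha_add_padicValNat_tamagawa_le_of_additive_potGood_of_irreducible_of_fineSelmerDual_fg)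
    (hGZK : rank_eq_analyticRank_of_analyticRank_le_one) (hmod : hasEntireLFunction_rat)
    {W : WeierstrassCurve ℚ} [W.IsElliptic] [W.IsGloballyMinimal] (hWeq : W = (⟨0, 0, 0, (-426751875), 3393216461250⟩ : WeierstrassCurve ℚ))
    (hr : W.analyticRank = 0)
    (e : W.geomTorsion (5 : ℕ) ≃+ (Fin 2 → ZMod 5)) {ε : ZMod 5} (hε : ¬ IsSquare ε)
    (he : ∀ σ : absoluteGaloisGroup ℚ, ∃ M ∈ nonsplitCartanNormalizer ε, ∀ P : W.geomTorsion (5 : ℕ), e (σ • P) = M *ᵥ e P)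
    (σx σs : absoluteGaloisGroup ℚ) (hσx : ∀ P : W.geomTorsion (5 : ℕ), e (σx • P) = !![1, ε * (4 - ε); 4 - ε, 1] *ᵥ e P)
    (hσs : ∀ P : W.geomTorsion (5 : ℕ), e (σs • P) = !![1, 0; 0, 4] *ᵥ e P)
    (hrank : Nat.card {d : ClassGroup (𝓞 ↥(fixedField (Subgroup.zpowers (absRestrictNormalHom (W.divisionField 5) σs)))) // d ^ 5 = 1} =
      Nat.card {d : ClassGroup (𝓞 ↥(fixedField (Subgroup.zpowers (absRestrictNormalHom (W.divisionField 5) σx ^ 12) ⊔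
        Subgroup.zpowers (absRestrictNormalHom (W.divisionField 5) σs)))) // d ^ 5 = 1}) :
    MissingUpperBoundAt W 5 := by
  subst hWeq
  exact missingUpperBoundAt_five_tame_of_nonsplitCartanBasis_of_rankEq' _ hKatoA hGZK hmod hr
    TameUpperUnitTwistRecords.addv_g435600ln1_5 TameUpperUnitTwistRecords.subTprime_g435600ln1_5 TameUpperUnitTwistRecords.irr_g435600ln1_5
    e hε he σx σs hσx hσs hrank

end Summit.BirchSwinnertonDyer.BirchSwinnertonDyer.Theorems.TameRankEqRecords

end
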